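import Summits.BirchSwinnertonDyer.BirchSwinnertonDyer.Theorems.GenusKolyvaginAtTwoK4NegPhantomDeepTwistPersistence
import Summits.BirchSwinnertonDyer.BirchSwinnertonDyer.Theorems.GenusKolyvaginAtTwoK4NegPhantomFramePrimeFrobenius
import HarnessLib

/-!
# Route `GenusKolyvaginAtTwo`, crux K₄⁻ `K4Neg` (stmt-BirchSwinnertonDyer-31526), the (β)/𝒫-frames — PHANTOM PERSISTENCE UNDER DEEP TWISTING, part 2:
# the `−ℓ₀`-twisted member of every deep genus pair carries the Lawson–Wuthrich class as well

Seat `bsd-line-gk2-p3` g35 (PROVER seat 3/3, cell `bsd-f1-sign2`), sequel of `…K4NegPhantomDeepTwistPersistence` (p792861), `--supports stmt-BirchSwinnertonDyer-31526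
--as helper`.  THEOREMS ONLY (no definition, no named fact, no `sorry`); standard axioms; UNCONDITIONAL.  **BSD is NOT proved by this file; K4Neg is neither proved nor
refuted by it; nothing is closed.**

WHY.  The memo `K4NEG-BETA-GENUS-VERDICT-gk2p3-g35.md` (evidence on the item) reads K4Neg's witness `P(n)` at a square-free product `n` of deep primes as the Heegner
`χ_n`-vector of the genus pair `(E^{(D_n)}, E^{(−ℓ₀D_n)})` over `K = ℚ(√−ℓ₀)`, and needs: the rank-`0` member of that pair has `Ш[2] ≠ 0`.  Part 1 §3 puts the phantom
`ξ_E` in `Sel₂(E^{(D_n)})`; THIS FILE puts it in `Sel₂(E^{(−ℓ₀D_n)})` on a 𝒫-frame (`4 ∣ a_{ℓ₀}(E)` ⟺ `loc_{ℓ₀} ξ_E = 0`, gk2-p4 g34's prime-frame trace bit), so that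
BOTH members carry `ξ_E` and the even one has `Ш[2] ∋ ξ_E` whatever the root numbers are.

WHAT.
* §1 `mem_torsionLocalKer_padic_of_deep_datum` — a deep Kolyvagin datum at `ℓ` (good, a Frobenius acting on `E[2]` as a complex conjugation, `4 ∣ a_ℓ`) kills `ξ`
  at `ℓ` (part 1 §3's step, exported); `mem_torsionLocalKer_padic_framePrime_of_four_dvd` — on a 𝒫-frame `ξ` is killed at the frame prime `ℓ₀` (the Frobenius
  supplied by `primesAbove_nonempty` / `exists_isArithFrobAt_of_mem_primesAbove_holds`).
* §2 ★★★ `two_le_natCard_selmerGroup_frameTwist_of_phantom_selmer_of_kolyvaginPrimes` — phantom cell + prime Heegner frame with `2` split + 𝒫 + `D ≡ 1 (8)` with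
  K4Neg-deep odd prime factors ⟹ **every elliptic model of `W^{(−ℓ₀·D)}` has `#Sel₂ ≥ 2`** (`−ℓ₀D ≡ 1 (8)` since `d_K ≡ 1 (8)`; part 1 §2 with the killed primes
  `ℓ ∣ D` and `ℓ₀`).

References: [GrossLMS1991] §3 (3.1)–(3.3), §9 Prop. 9.6; [MazurRubin2010] Lemma 2.10, Def. 3.1, Lemma 3.2; [LawsonWuthrich2016] §3, §7.1; [IrelandRosen1990] Prop. 13.1.4.
-/

set_option linter.dupNamespace false -- tree convention: `Summit.BirchSwinnertonDyer.BirchSwinnertonDyer.Theorems` (summit = sub-problem)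
set_option autoImplicit false

noncomputable section

open scoped Classical NumberField ContRepresentation

namespace Summit.BirchSwinnertonDyer.BirchSwinnertonDyer.Theorems.GenusExact.PhantomDescentBit.DeepTwist

open WeierstrassCurve Field NumberField IsDedekindDomain Function
open Literature.NumberTheory.EllipticCurves Literature.NumberTheory.GaloisRepresentations
open Summit.BirchSwinnertonDyer.BirchSwinnertonDyer.Theorems.GenusKolyTwistLocal
open Rat.HeightOneSpectrum (primesEquiv)

variable (W : WeierstrassCurve ℚ) [W.IsElliptic] [W.IsGloballyMinimal]

/-! ## §1 Deep data and the frame prime kill the phantom -/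

/-- **A deep Kolyvagin datum kills the Lawson–Wuthrich class at `ℓ`** (the step of part 1 §3 exported): `ρ̄_{W,2}`, `ρ_{W,4}` onto, `Δ < 0`, `ξ ≠ 0` dying on
`Γ_{ℚ(E[4])}`; `ℓ ≠ 2` a prime not dividing `N_W` with an arithmetic Frobenius acting on `E[2]` as a complex conjugation and `4 ∣ a_ℓ(W)` ⟹
`ξ ∈ W.torsionLocalKer ℚ_ℓ 2` (gk2-p4 g34's trace bit). [cite: GrossLMS1991, §3 (3.2)–(3.3), §9 Prop. 9.6] [cite: LawsonWuthrich2016, §7.1] -/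
theorem mem_torsionLocalKer_padic_of_deep_datum (hΔ : W.Δ < 0)
    (hsurj : W.HasSurjectiveModNGaloisRep 2) (hsurj4 : W.HasSurjectiveModNGaloisRep 4)
    {ξ : galH1Torsion W (2 : ℤ)} (hξ0 : ξ ≠ 0) (hξ4 : ∀ h ∈ torsionFixing W (4 : ℤ), h1Eval W (2 : ℤ) ξ h = 0)
    {ℓ : ℕ} [Fact ℓ.Prime] (hℓ2 : ℓ ≠ 2) (hℓN : ¬ ℓ ∣ W.conductorNorm ℤ) (h4 : (4 : ℤ) ∣ W.frobeniusTrace ℓ)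
    {v : HeightOneSpectrum (𝓞 ℚ)} {𝔓 : Ideal (absIntegers (𝓞 ℚ) ℚ)} {γ c₀ : absoluteGaloisGroup ℚ}
    (hℓv : (ℓ : 𝓞 ℚ) ∈ v.asIdeal) (h𝔓 : 𝔓 ∈ v.primesAbove) (hγ : IsArithFrobAt (𝓞 ℚ) γ 𝔓)
    (hc₀ : IsComplexConjugation (Rat.castHom ℝ) c₀) (hγc : ∀ T : geomTorsion W (2 : ℤ), γ • T = c₀ • T) :
    ξ ∈ W.torsionLocalKer ℚ_[ℓ] (2 : ℤ) := by
  have hℓ : ℓ.Prime := Fact.out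
  have hW : W.HasGoodReductionAt v := by
    by_contra h
    exact hℓN ((GenusKolyTwistingPrime.primesEquiv_eq hℓ hℓv) ▸ (W.dvd_conductorNorm_iff v).mpr h)
  have hsq : c₀ * c₀ = 1 := by have h := hc₀.sq_eq_one; rwa [sq] at h
  have hinv : ∀ T : geomTorsion W (2 : ℤ), γ • γ • T = T := fun T ↦ by
    rw [hγc, hγc, ← mul_smul, hsq, one_smul]
  have hγT : ∃ T : geomTorsion W (2 : ℤ), γ • T ≠ T := by
    obtain ⟨T, hT'⟩ := KolyvaginEigenTwo.exists_twoTorsion_smul_ne_of_Δ_neg W hΔ hc₀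
    exact ⟨T, fun h ↦ hT' (by rw [← hγc, h])⟩
  exact (TraceBit.mem_torsionLocalKer_padic_iff_four_dvd_frobeniusTrace W hsurj hsurj4 hξ0 hξ4 hℓ2 hℓv hW h𝔓 hγ
    hinv hγT).mpr h4

/-- **On a 𝒫-frame the Lawson–Wuthrich class is killed at the frame prime `ℓ₀` too.**  `K` imaginary quadratic with odd `d_K = −ℓ₀` (`ℓ₀` prime), Heegner for
`N_W`; `ρ̄_{W,2}`, `ρ_{W,4}` onto, `Δ < 0`, `ξ ≠ 0` dying on `Γ_{ℚ(E[4])}`; 𝒫: `4 ∣ a_{ℓ₀}(W)`.  Then `ξ ∈ W.torsionLocalKer ℚ_{ℓ₀} 2` (gk2-p4 g34's prime-frame trace bit,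
the Frobenius supplied by `primesAbove_nonempty` / `exists_isArithFrobAt_of_mem_primesAbove_holds`). [cite: GrossLMS1991, §9 Prop. 9.6] [cite: LawsonWuthrich2016, §7.1] -/
theorem mem_torsionLocalKer_padic_framePrime_of_four_dvd {K : Type} [Field K] [NumberField K] (hΔ : W.Δ < 0)
    (hsurj : W.HasSurjectiveModNGaloisRep 2) (hsurj4 : W.HasSurjectiveModNGaloisRep 4)
    {ξ : galH1Torsion W (2 : ℤ)} (hξ0 : ξ ≠ 0) (hξ4 : ∀ h ∈ torsionFixing W (4 : ℤ), h1Eval W (2 : ℤ) ξ h = 0)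
    (hK : IsImaginaryQuadratic K) (hodd : Odd (discr K)) (hH : SatisfiesHeegnerHypothesis (W.conductorNorm ℤ) K)
    {ℓ₀ : ℕ} [Fact ℓ₀.Prime] (hd : discr K = -(ℓ₀ : ℤ)) (h4 : (4 : ℤ) ∣ W.frobeniusTrace ℓ₀) :
    ξ ∈ W.torsionLocalKer ℚ_[ℓ₀] (2 : ℤ) := by
  have hℓ₀ : ℓ₀.Prime := Fact.out
  obtain ⟨v, hv⟩ : ∃ v : HeightOneSpectrum (𝓞 ℚ), ((primesEquiv v : Nat.Primes) : ℕ) = ℓ₀ :=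
    ⟨primesEquiv.symm ⟨ℓ₀, hℓ₀⟩, by rw [Equiv.apply_symm_apply]⟩
  have hℓv : (ℓ₀ : 𝓞 ℚ) ∈ v.asIdeal := by
    rw [← hv]
    exact Rat.HeightOneSpectrum.natCast_natGenerator_mem v
  obtain ⟨𝔓, h𝔓⟩ := IsDedekindDomain.HeightOneSpectrum.primesAbove_nonempty v
  obtain ⟨γ, hγ⟩ := IsDedekindDomain.HeightOneSpectrum.exists_isArithFrobAt_of_mem_primesAbove_holds (v := v) h𝔓
  exact (TraceBit.mem_torsionLocalKer_padic_iff_four_dvd_of_prime_frame W hsurj hsurj4 hΔ hξ0 hξ4 hK hodd hH hd hℓv h𝔓 hγ).mpr h4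

/-! ## §2 ★★★ The `−ℓ₀`-twisted member of a deep genus pair on a 𝒫-frame -/

variable [NeZero (W.conductorNorm ℤ)]

/-- ★★★ **THE 𝒫-FRAME PARTNER CARRIES THE PHANTOM TOO.**  Phantom cell (`W/ℚ` globally minimal, `C(W)` odd, off the cut, `Δ < 0`, `ρ̄_{W,2}`, `ρ_{W,4}` onto, the
Lawson–Wuthrich class `ξ` SELMER) at a prime Heegner frame `K = ℚ(√−ℓ₀)` (`d_K = −ℓ₀` odd, Heegner for `N_W`, `2` split) which is 𝒫: `4 ∣ a_{ℓ₀}(W)`.  For ANY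
integer `D ≠ 0` with `D ≡ 1 (mod 8)` all of whose odd prime factors are K4Neg-deep (`ℓ ≠ ℓ₀`, `ℓ ∤ N_W`, `FrobEqFrobInfty W K 2 ℓ`, `2 ≤ kolyvaginIndex W 2 ℓ`):
**every elliptic model of `W^{(−ℓ₀·D)}` has `#Sel₂ ≥ 2`** — with part 1 §3 (`W^{(D)}`), BOTH members of the deep genus pair `(E^{(D_n)}, E^{(−ℓ₀D_n)})` carry `ξ_E`
in `Sel₂`, so whichever has rank `0` has `Ш[2] ≠ 0` (memo §4: the input of «`Γ_n = 0` on 𝒫»).  Proof: part 1 §2 with the killed primes `ℓ ∣ D` (§1 first lemma) and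
`ℓ₀` (second lemma); `−ℓ₀D ≡ 1 (8)` because `2` splits in `K` (`d_K ≡ 1 (8)`).  BSD is NOT proved by this; K4Neg is neither proved nor refuted here.
[cite: GrossLMS1991, §3 (3.1)–(3.3), §9 Prop. 9.6] [cite: MazurRubin2010, Lemma 2.10, Def. 3.1, Lemma 3.2] [cite: LawsonWuthrich2016, §3, §7.1]
[cite: IrelandRosen1990, Prop. 13.1.4] -/
theorem two_le_natCard_selmerGroup_frameTwist_of_phantom_selmer_of_kolyvaginPrimes {K : Type} [Field K] [NumberField K]
    (hT : Odd W.tamagawaProduct)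
    (hoff : ¬ ∃ v : HeightOneSpectrum (𝓞 ℚ), ((2 : ℕ) : 𝓞 ℚ) ∉ v.asIdeal ∧ ((W.conductorNorm ℤ : ℕ) : 𝓞 ℚ) ∈ v.asIdeal ∧
      W.HasMultiplicativeReductionAt v)
    (hΔ : W.Δ < 0) (hsurj : W.HasSurjectiveModNGaloisRep 2) (hsurj4 : W.HasSurjectiveModNGaloisRep 4)
    {ξ : galH1Torsion W (2 : ℤ)} (hξ0 : ξ ≠ 0) (hξ4 : ∀ h ∈ torsionFixing W (4 : ℤ), h1Eval W (2 : ℤ) ξ h = 0)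
    (hξS : ξ ∈ W.selmerGroup 2)
    (hK : IsImaginaryQuadratic K) (hodd : Odd (discr K)) (hH : SatisfiesHeegnerHypothesis (W.conductorNorm ℤ) K)
    (h2K : ((Ideal.span {(2 : ℤ)}).primesOver (𝓞 K)).ncard = 2)
    {ℓ₀ : ℕ} (hℓ₀ : ℓ₀.Prime) (hd : discr K = -(ℓ₀ : ℤ)) (hP : (4 : ℤ) ∣ W.frobeniusTrace ℓ₀)
    {D : ℤ} (hD : D ≠ 0) (h8 : (8 : ℤ) ∣ D - 1)
    (hdeep : ∀ (ℓ : ℕ), ℓ.Prime → ℓ ≠ 2 → (ℓ : ℤ) ∣ D →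
      ℓ ≠ ℓ₀ ∧ ¬ ℓ ∣ W.conductorNorm ℤ ∧ FrobEqFrobInfty W K 2 ℓ ∧ 2 ≤ Zhang2014.kolyvaginIndex W 2 ℓ)
    (Wd' : WeierstrassCurve ℚ) [Wd'.IsElliptic] {C : VariableChange ℚ}
    (hWd' : C • W.quadraticTwist ((-(ℓ₀ : ℤ) * D : ℤ) : ℚ) = Wd') :
    2 ≤ Nat.card (Wd'.selmerGroup 2) := by
  haveI : Fact ℓ₀.Prime := ⟨hℓ₀⟩
  obtain ⟨hℓ₀2, hℓ₀N, -⟩ := GenusKolyTwin.prime_discr_facts W hK hodd hH hℓ₀ hd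
  -- `−ℓ₀ ≡ 1 (8)` (2 splits in `K`) and `D ≡ 1 (8)` ⟹ `−ℓ₀·D ≡ 1 (8)`
  have hK8 : discr K % 8 = 1 := (Literature.NumberTheory.QuadraticFields.Quadratic.ncard_primesOver_two_eq_two_iff hK.1).mp h2K
  have hℓ8 : (8 : ℤ) ∣ -(ℓ₀ : ℤ) - 1 := by
    rw [← hd]
    omega
  have h8' : (8 : ℤ) ∣ -(ℓ₀ : ℤ) * D - 1 := by
    have : -(ℓ₀ : ℤ) * D - 1 = -(ℓ₀ : ℤ) * (D - 1) + (-(ℓ₀ : ℤ) - 1) := by ring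
    rw [this]
    exact dvd_add (dvd_mul_of_dvd_right h8 _) hℓ8
  have hD0 : -(ℓ₀ : ℤ) * D ≠ 0 := mul_ne_zero (neg_ne_zero.mpr (by exact_mod_cast hℓ₀.ne_zero)) hD
  refine two_le_natCard_selmerGroup_twist_of_selmer_of_offCut W hT hoff hΔ (ξ := ξ) hξ0 hξS hD0 Wd' hWd'
    (fun v h2v ↦ Or.inl (exists_sq_eq_adicCompletion_two_of_eight_dvd h8' v h2v)) ?_
  intro ℓ _ hℓ2 hℓD
  have hℓ : ℓ.Prime := Fact.out
  by_cases hℓℓ₀ : ℓ = ℓ₀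
  · -- the frame prime
    subst hℓℓ₀
    exact ⟨hℓ₀N, mem_torsionLocalKer_padic_framePrime_of_four_dvd W hΔ hsurj hsurj4 hξ0 hξ4 hK hodd hH hd hP⟩
  · -- a deep prime dividing `D`
    have hℓD' : (ℓ : ℤ) ∣ D := by
      rcases (Nat.prime_iff_prime_int.mp hℓ).dvd_or_dvd hℓD with h | h
      · exfalso
        have h' : (ℓ : ℤ) ∣ (ℓ₀ : ℤ) := (dvd_neg).mp h
        have : ℓ ∣ ℓ₀ := by exact_mod_cast h'
        exact hℓℓ₀ ((Nat.prime_dvd_prime_iff_eq hℓ hℓ₀).mp this)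
      · exact h
    obtain ⟨-, hℓN, hF, hk⟩ := hdeep ℓ hℓ hℓ2 hℓD'
    obtain ⟨h4, v, 𝔓, γ, c₀, hℓv, h𝔓, hγ, hc₀, hγc⟩ := deep_datum_of_frobEqFrobInfty_of_le_kolyvaginIndex W hF hk
    exact ⟨hℓN, mem_torsionLocalKer_padic_of_deep_datum W hΔ hsurj hsurj4 hξ0 hξ4 hℓ2 hℓN h4 hℓv h𝔓 hγ hc₀ hγc⟩

end Summit.BirchSwinnertonDyer.BirchSwinnertonDyer.Theorems.GenusExact.PhantomDescentBit.DeepTwist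

end
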